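import Mathlib
import HarnessLib
import Literature.Probability.MarkovChains.ReversibleSpectrumReal
import Literature.Probability.MarkovChains.RelaxationTimeVarianceDecay

/-!
# The variance of time averages: `E_π[(Σ_{s<t} f(X_s))²] ≤ 2t·E_π(f²)/γ` (Levin–Peres–Wilmer Lemma 12.22)

HONEST FRAMING: exact (Metropolis-corrected) sampling algorithms for lattice gauge theory; figures
of merit are autocorrelation/cost numbers at stated couplings and volumes; no continuum-physics claim.

Conventions of `PeskunOrdering.lean` (`piInner π g h = ⟨g,h⟩_π`, `centred π f = f̄ = f − E_π f`,
`varSum f π P N = Var_π[Σ_{t=1}^N f(X_t)]` for the STATIONARY chain, with the recursion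
`varSum_succ_sub`), `DistinguishingStatistic.lean` (`lawVariance π f = Var_π(f) = E_π(f̄²)`),
`SpectralRepresentation.lean` (the `π`-orthonormal eigenbasis `specFun hA j = f_j`, `specVal hA j =
λ_j` of a reversible `P`, Lemma 12.2), `RelaxationTimeVarianceDecay.lean` (the expansion
`f = Σ_j ⟨f,f_j⟩_π f_j`), `SpectralGapVariational.lean` / `ReversibleSpectrumReal.lean`
(`spectralGap π P = γ = 1 − λ₂`, Lemma 13.7, `orthEigenvalues_eq`).  Source: D. A. Levin, Y. Peres
(with E. L. Wilmer), *Markov Chains and Mixing Times*, 2nd ed., AMS 2017 [LevinPeres2017], §12.7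
"Time averages".  Everything is PROVED (finite sums; 0 named facts).

Setting: `P` reversible with respect to the positive probability vector `π` on a finite `X`
(`|X| ≥ 2`), irreducible (so that `γ > 0` and the harmonic functions are constant); the chain is
started from `π`, so `E_π[(Σ_{s<t} f(X_s))²]` for `E_π f = 0` is the tree's `varSum f π P t` (and for a
general `f` the book's statement is applied to `f − E_π f`: `varSum` is the variance).

* `pow_mulVec_specFun` (`Pᵏ f_j = λ_jᵏ f_j`), `piInner_pow_mulVec_eq_sum` — the stationary
  autocovariance in the eigenbasis: **`⟨g, Pᵏg⟩_π = Σ_j ⟨g,f_j⟩²_π λ_jᵏ`** ("`E_π[f_j(X_s)f_k(X_r)] =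
  λ_j^{s−r} E_π(f_k f_j)`", Parseval) [cite: LevinPeres2017, §12.7, proof of Lemma 12.22 (the two
  displayed conditional-expectation computations and (12.33))];
* `varSum_eq_sum_range` (`Var_π[S_N] = Σ_{r<N} (‖f̄‖²_π + 2Σ_{i<r} ⟨f̄, P^{i+1}f̄⟩_π)`, "considering
  separately the diagonal and cross terms when expanding the square") and **(12.32)–(12.33)**
  `varSum_eq_sum_modes`: `Var_π[S_N] = Σ_j a_j² E_j(N)` with `a_j = ⟨f̄,f_j⟩_π` and
  `E_j(N) = Σ_{r<N}(1 + 2Σ_{i<r} λ_j^{i+1}) = N + 2Σ_{r<N}Σ_{s=1}^{r} λ_j^s` [cite: LevinPeres2017, §12.7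
  eqs. (12.32)–(12.33)];
* `one_sub_mul_modeSum_le` — **(12.30) for one mode**: `(1 − λ)·E(N) ≤ 2N` for every `−1 ≤ λ ≤ 1`
  ("Evaluating the geometric sum … `t(1 + λ) − 2λg(λ) ≤ 2t`"; here termwise:
  `(1−λ)(1 + 2Σ_{i<r}λ^{i+1}) = 1 + λ − 2λ^{r+1} ≤ 2`, which needs no restriction `t ≥ 2`)
  [cite: LevinPeres2017, §12.7 Lemma 12.22 eq. (12.30) (proof)]; `LevinPeres2017_eq_12_30`: for an
  eigenfunction `f_j` of the orthonormal basis with `λ_j ≠ 1`, **`E_π[(Σ_{s<t} f_j(X_s))²] ≤ 2t/(1 − λ_j)`**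
  [cite: LevinPeres2017, §12.7 Lemma 12.22 eq. (12.30)];
* **LEMMA 12.22, eq. (12.31)** `LevinPeres2017_lemma_12_22`: for a reversible irreducible `P`
  (positive stationary probability vector `π`, `|X| ≥ 2`) and every `f`,
  **`Var_π[Σ_{s<t} f(X_s)] ≤ 2t·Var_π(f)/γ`** — the book's `E_π[(Σ_{s<t} f(X_s))²] ≤ 2tE_π(f²)/γ` for
  `E_π(f) = 0` [cite: LevinPeres2017, §12.7 Lemma 12.22 eq. (12.31)]; `spectralGap_pos` (`γ > 0` for an
  irreducible reversible chain on `≥ 2` points) [cite: LevinPeres2017, §12.2 (Lemma 12.1 (ii) with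
  eq. (12.7): `λ₂ < 1` for irreducible `P`)].  Consequence `LevinPeres2017_lemma_12_22_avg`:
  `Var_π[t⁻¹Σ_{s<t} f(X_s)] ≤ 2Var_π(f)/(γt)` — "order `[Var_π(f)/η²]γ⁻¹` samples suffice".

Context (cell pub-lqcd, venture LatticeQCDFlow): (12.31) is the rigorous statement that a stationary
reversible sampler delivers at least `γt/2` "effective samples" in `t` steps for EVERY observable —
the spectral-gap form of the ESS / integrated-autocorrelation figure of merit.
-/

namespace Literature.Probability.MarkovChains

open Finset Matrix

variable {X : Type*} [Fintype X] [DecidableEq X]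

section Spectral

variable {π : X → ℝ} {P : Matrix X X ℝ}

omit [DecidableEq X] in
/-- `(M v)_x = Σ_y M x y v_y`. [folklore] -/
private theorem mulVec_apply₅ (M : Matrix X X ℝ) (v : X → ℝ) (x : X) :
    (M *ᵥ v) x = ∑ y, M x y * v y := rfl

/-- `Pᵏ f_j = λ_jᵏ f_j` for the orthonormal eigenfunctions of a reversible `P` (`π > 0`).
[cite: LevinPeres2017, §12.7, proof of Lemma 12.22 ("`E_π(φ(X_s) | X_r) = (P^{s−r}φ)(X_r)`",
"Since `φ` is an eigenfunction …" `= λ^{s−r}φ`)] -/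
theorem pow_mulVec_specFun (hπ : ∀ x, 0 < π x) (hA : (symmMatrix π P).IsHermitian) (j : X)
    (k : ℕ) : (P ^ k) *ᵥ specFun hA j = specVal hA j ^ k • specFun hA j := by
  induction k with
  | zero => rw [pow_zero, one_mulVec, pow_zero, one_smul]
  | succ k ih =>
    rw [pow_succ, ← mulVec_mulVec, mulVec_specFun hπ hA j, mulVec_smul, ih, smul_smul, ← pow_succ']

/-- **The stationary autocovariance in the eigenbasis**: `⟨g, Pᵏ g⟩_π = Σ_j ⟨g,f_j⟩²_π λ_jᵏ` for a
reversible `P` (`π > 0`) — "`E_π[f_j(X_s)f_k(X_r)] = λ_j^{s−r}E_π(f_k f_j) = 0` for `j ≠ k`" and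
Parseval. [cite: LevinPeres2017, §12.7, proof of Lemma 12.22 (the computation leading to (12.33))] -/
theorem piInner_pow_mulVec_eq_sum (hπ : ∀ x, 0 < π x) (hA : (symmMatrix π P).IsHermitian)
    (g : X → ℝ) (k : ℕ) :
    piInner π g ((P ^ k) *ᵥ g) = ∑ j, piInner π g (specFun hA j) ^ 2 * specVal hA j ^ k := by
  -- `(Pᵏ g)(x) = Σ_j ⟨g,f_j⟩_π λ_jᵏ f_j(x)`
  have hexp : ∀ x, ((P ^ k) *ᵥ g) x =
      ∑ j, piInner π g (specFun hA j) * specVal hA j ^ k * specFun hA j x := by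
    intro x
    rw [mulVec_apply₅]
    calc ∑ y, (P ^ k) x y * g y
        = ∑ y, (P ^ k) x y * ∑ j, piInner π g (specFun hA j) * specFun hA j y :=
          sum_congr rfl fun y _ => by rw [sum_piInner_specFun_mul hπ hA g y]
      _ = ∑ j, piInner π g (specFun hA j) * ∑ y, (P ^ k) x y * specFun hA j y := by
          simp_rw [mul_sum]
          rw [sum_comm]
          exact sum_congr rfl fun j _ => sum_congr rfl fun y _ => by ring
      _ = ∑ j, piInner π g (specFun hA j) * specVal hA j ^ k * specFun hA j x := by
          refine sum_congr rfl fun j _ => ?_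
          have h := congr_fun (pow_mulVec_specFun hπ hA j k) x
          rw [mulVec_apply₅, Pi.smul_apply, smul_eq_mul] at h
          rw [h, mul_assoc]
  -- `⟨g, Pᵏg⟩_π = Σ_j ⟨g,f_j⟩_π λ_jᵏ ⟨g,f_j⟩_π`
  show ∑ x, π x * (g x * ((P ^ k) *ᵥ g) x) = _
  calc ∑ x, π x * (g x * ((P ^ k) *ᵥ g) x)
      = ∑ x, π x * (g x * ∑ j, piInner π g (specFun hA j) * specVal hA j ^ k * specFun hA j x) := by
        simp_rw [hexp]
    _ = ∑ j, piInner π g (specFun hA j) * specVal hA j ^ k * ∑ x, π x * (g x * specFun hA j x) := by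
        simp_rw [mul_sum]
        rw [sum_comm]
        exact sum_congr rfl fun j _ => sum_congr rfl fun x _ => by ring
    _ = ∑ j, piInner π g (specFun hA j) ^ 2 * specVal hA j ^ k :=
        sum_congr rfl fun j _ => by rw [show ∑ x, π x * (g x * specFun hA j x) =
          piInner π g (specFun hA j) from rfl]; ring

end Spectral

/-! ## `Var_π[S_N]` expanded: (12.32)–(12.33) -/

section Variance

variable {π : X → ℝ} {P : Matrix X X ℝ}

/-- "Considering separately the diagonal and cross terms when expanding the square":
`Var_π[Σ_{t=1}^N f(X_t)] = Σ_{r<N} (‖f̄‖²_π + 2 Σ_{i<r} ⟨f̄, P^{i+1} f̄⟩_π)` for the stationary chain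
(row-stochastic `P`, `πP = π`). [cite: LevinPeres2017, §12.7, proof of Lemma 12.22, eq. (12.32)] -/
theorem varSum_eq_sum_range (hπ1 : ∑ x, π x = 1) (hP : IsRowStochastic P) (hst : IsStationary π P)
    (f : X → ℝ) (N : ℕ) :
    varSum f π P N = ∑ r ∈ range N, (piInner π (centred π f) (centred π f) +
      2 * ∑ i ∈ range r, piInner π (centred π f) ((P ^ (i + 1)) *ᵥ centred π f)) := by
  induction N with
  | zero => rw [varSum_zero, sum_range_zero]
  | succ N ih =>
    rw [sum_range_succ, ← ih]
    have h := varSum_succ_sub hπ1 hP hst N f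
    rw [Fin.sum_univ_eq_sum_range
      (fun i => piInner π (centred π f) ((P ^ (i + 1)) *ᵥ centred π f)) N] at h
    linarith

/-- **(12.32)–(12.33): `Var_π[S_N] = Σ_j a_j²·E_j(N)`** with `a_j = ⟨f̄, f_j⟩_π` and the one-mode sum
`E_j(N) = Σ_{r<N} (1 + 2Σ_{i<r} λ_j^{i+1})` (`= N + 2Σ_{r<N}Σ_{s=1}^{r} λ_j^s`, the right side of
(12.32)), for a reversible `P` with positive stationary probability vector `π`.
[cite: LevinPeres2017, §12.7, proof of Lemma 12.22, eqs. (12.32)–(12.33)] -/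
theorem varSum_eq_sum_modes (hπ : ∀ x, 0 < π x) (hπ1 : ∑ x, π x = 1) (hP : IsRowStochastic P)
    (hDB : DetailedBalance π P) (hA : (symmMatrix π P).IsHermitian) (f : X → ℝ) (N : ℕ) :
    varSum f π P N = ∑ j, piInner π (centred π f) (specFun hA j) ^ 2 *
      ∑ r ∈ range N, (1 + 2 * ∑ i ∈ range r, specVal hA j ^ (i + 1)) := by
  have hst : IsStationary π P := hDB.isStationary hP.2
  have h0 : piInner π (centred π f) (centred π f) =
      ∑ j, piInner π (centred π f) (specFun hA j) ^ 2 := by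
    have := piInner_pow_mulVec_eq_sum hπ hA (centred π f) 0
    rw [pow_zero, one_mulVec] at this
    rw [this]
    exact sum_congr rfl fun j _ => by rw [pow_zero, mul_one]
  rw [varSum_eq_sum_range hπ1 hP hst f N]
  calc ∑ r ∈ range N, (piInner π (centred π f) (centred π f) +
        2 * ∑ i ∈ range r, piInner π (centred π f) ((P ^ (i + 1)) *ᵥ centred π f))
      = ∑ r ∈ range N, ∑ j, piInner π (centred π f) (specFun hA j) ^ 2 *
          (1 + 2 * ∑ i ∈ range r, specVal hA j ^ (i + 1)) := by
        refine sum_congr rfl fun r _ => ?_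
        rw [h0]
        simp_rw [piInner_pow_mulVec_eq_sum hπ hA (centred π f)]
        -- `Σ_j a_j² + 2Σ_i Σ_j a_j² λ_j^{i+1} = Σ_j a_j²(1 + 2Σ_i λ_j^{i+1})`
        rw [sum_comm, mul_sum, ← sum_add_distrib]
        refine sum_congr rfl fun j _ => ?_
        rw [← mul_sum]
        ring
    _ = ∑ j, ∑ r ∈ range N, piInner π (centred π f) (specFun hA j) ^ 2 *
          (1 + 2 * ∑ i ∈ range r, specVal hA j ^ (i + 1)) := sum_comm
    _ = _ := sum_congr rfl fun j _ => by rw [← mul_sum]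

omit [Fintype X] [DecidableEq X] in
/-- **(12.30) for one mode**: for `−1 ≤ λ ≤ 1`, `(1 − λ)·Σ_{r<N}(1 + 2Σ_{i<r} λ^{i+1}) ≤ 2N` — the
geometric-sum evaluation "`= [t(1+λ) − 2λg(λ)]/(1−λ) ≤ 2t/(1−λ)`", here termwise:
`(1−λ)(1 + 2Σ_{i<r}λ^{i+1}) = 1 + λ − 2λ^{r+1} ≤ 2`. [cite: LevinPeres2017, §12.7, proof of Lemma 12.22
eq. (12.30) ("Evaluating the geometric sum shows that …")] -/
theorem one_sub_mul_modeSum_le {lam : ℝ} (h1 : -1 ≤ lam) (h2 : lam ≤ 1) (N : ℕ) :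
    (1 - lam) * ∑ r ∈ range N, (1 + 2 * ∑ i ∈ range r, lam ^ (i + 1)) ≤ 2 * N := by
  have hgeom : ∀ r, (1 - lam) * ∑ i ∈ range r, lam ^ (i + 1) = lam - lam ^ (r + 1) := by
    intro r
    induction r with
    | zero => simp
    | succ r ih => rw [sum_range_succ, mul_add, ih]; ring
  have hterm : ∀ r, (1 - lam) * (1 + 2 * ∑ i ∈ range r, lam ^ (i + 1)) =
      1 + lam - 2 * lam ^ (r + 1) := by
    intro r
    linear_combination 2 * hgeom r
  have hle : ∀ r, 1 + lam - 2 * lam ^ (r + 1) ≤ 2 := by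
    intro r
    rcases le_or_gt 0 lam with hl | hl
    · have : 0 ≤ lam ^ (r + 1) := pow_nonneg hl _
      linarith
    · -- `λ < 0`: `λ^{r+1} ≥ −|λ|^{r+1} ≥ −|λ| = λ`
      have habs : |lam ^ (r + 1)| ≤ |lam| := by
        rw [abs_pow]
        exact pow_le_of_le_one (abs_nonneg _) (abs_le.2 ⟨by linarith, h2⟩) (Nat.succ_ne_zero r)
      have h3 : -lam ^ (r + 1) ≤ |lam| := (neg_le_abs _).trans habs
      have h4 : |lam| = -lam := abs_of_neg hl
      linarith
  rw [mul_sum]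
  calc ∑ r ∈ range N, (1 - lam) * (1 + 2 * ∑ i ∈ range r, lam ^ (i + 1))
      ≤ ∑ _r ∈ range N, (2 : ℝ) := sum_le_sum fun r _ => by rw [hterm]; exact hle r
    _ = 2 * N := by rw [sum_const, card_range, nsmul_eq_mul, mul_comm]

/-- `|λ_j| ≤ 1` for every eigenvalue of the basis with `λ_j ≠ 1` (Lemma 12.1 (i) via `λ⋆ ≤ 1`).
[cite: LevinPeres2017, §12.1 Lemma 12.1 (i)] -/
theorem abs_specVal_le_one (hπ : ∀ x, 0 < π x) (hP : IsRowStochastic P)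
    (hA : (symmMatrix π P).IsHermitian) {j : X} (hj : specVal hA j ≠ 1) : |specVal hA j| ≤ 1 :=
  (abs_specVal_le_lambdaStar hπ hA hj).trans (lambdaStar_le_one hP)

/-- **(12.30)**: for an eigenfunction `φ = f_j` of the `π`-orthonormal basis with eigenvalue
`λ_j ≠ 1` (reversible `P`, positive stationary probability vector `π`),
`E_π[(Σ_{s<t} φ(X_s))²] = Var_π[Σ_{s<t} φ(X_s)] ≤ 2t/(1 − λ_j)` (`E_π φ = 0` by Lemma 12.3).
[cite: LevinPeres2017, §12.7 Lemma 12.22 eq. (12.30)] -/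
theorem LevinPeres2017_eq_12_30 (hπ : ∀ x, 0 < π x) (hπ1 : ∑ x, π x = 1) (hP : IsRowStochastic P)
    (hDB : DetailedBalance π P) (hA : (symmMatrix π P).IsHermitian) {j : X} (hj : specVal hA j ≠ 1)
    (t : ℕ) : varSum (specFun hA j) π P t ≤ 2 * t / (1 - specVal hA j) := by
  have hst : IsStationary π P := hDB.isStationary hP.2
  -- `E_π f_j = 0`, so `f̄_j = f_j` and `a_i = ⟨f_j, f_i⟩_π = δ_ij`
  have hmean : ∑ y, π y * specFun hA j y = 0 :=
    sum_mul_eq_zero_of_mulVec_eq_smul hst (mulVec_specFun hπ hA j) hj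
  have hcen : centred π (specFun hA j) = specFun hA j := by
    funext x; unfold centred; rw [hmean, sub_zero]
  have hl := abs_le.1 (abs_specVal_le_one hπ hP hA hj)
  have h1l : 0 < 1 - specVal hA j := by
    rcases (hl.2).lt_or_eq with h | h
    · linarith
    · exact absurd h hj
  rw [varSum_eq_sum_modes hπ hπ1 hP hDB hA, le_div_iff₀ h1l, hcen]
  simp_rw [piInner_specFun hπ hA]
  rw [Finset.sum_eq_single j (fun i _ hi => by rw [if_neg (Ne.symm hi)]; ring)
    (fun h => absurd (mem_univ j) h), if_pos rfl, one_pow, one_mul, mul_comm]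
  exact one_sub_mul_modeSum_le hl.1 hl.2 t

/-- **`γ > 0` for an irreducible reversible chain** on a finite `X` with `|X| ≥ 2` and positive
stationary probability vector `π`: `λ₂ < 1` (`λ₂` is one of the `λ_j ≠ 1`, and `λ_j ≤ 1`).
[cite: LevinPeres2017, §12.2 eq. (12.7) (`1 = λ₁ > λ₂`) with §12.1 Lemma 12.1] -/
theorem spectralGap_pos [Nontrivial X] (hπ : ∀ x, 0 < π x) (hπ1 : ∑ x, π x = 1)
    (hP : IsRowStochastic P) (hDB : DetailedBalance π P) (hirr : IsIrreducible P) :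
    0 < spectralGap π P := by
  have hA := symmMatrix_isHermitian hπ hDB
  have hmem := (isGreatest_orthEigenvalues hπ hπ1 hP hDB).1
  rw [orthEigenvalues_eq hπ hπ1 hP hDB hirr hA] at hmem
  obtain ⟨j, hj, hjeq⟩ := hmem
  have hj' : specVal hA j ≠ 1 := hj
  have hle := (abs_le.1 (abs_specVal_le_one hπ hP hA hj')).2
  have hlt : specVal hA j < 1 := lt_of_le_of_ne hle hj'
  rw [LevinPeres2017_lemma_13_7 hπ hπ1 hP hDB]
  linarith

/-- **Lemma 12.22, eq. (12.31).**  Let `P` be reversible and irreducible with positive stationary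
probability vector `π` on a finite `X` (`|X| ≥ 2`), with spectral gap `γ`.  For every `f : X → ℝ`,
the stationary chain satisfies **`Var_π[Σ_{s<t} f(X_s)] ≤ 2t·Var_π(f)/γ`** — the book's
`E_π[(Σ_{s=0}^{t−1} f(X_s))²] ≤ 2tE_π(f²)/γ` for `E_π(f) = 0`.  Proof as printed: expand in the
orthonormal eigenbasis ((12.32)–(12.33)), bound each mode by (12.30), and use `1 − λ_j ≥ γ` for
`λ_j ≠ 1` (the `λ_j = 1` mode carries `a_1 = ⟨f̄, 1⟩_π = 0`). [cite: LevinPeres2017, §12.7 Lemma 12.22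
eq. (12.31)] -/
theorem LevinPeres2017_lemma_12_22 [Nontrivial X] (hπ : ∀ x, 0 < π x) (hπ1 : ∑ x, π x = 1)
    (hP : IsRowStochastic P) (hDB : DetailedBalance π P) (hirr : IsIrreducible P) (f : X → ℝ)
    (t : ℕ) : varSum f π P t ≤ 2 * t * lawVariance π f / spectralGap π P := by
  have hst : IsStationary π P := hDB.isStationary hP.2
  have hA := symmMatrix_isHermitian hπ hDB
  have hγ := spectralGap_pos hπ hπ1 hP hDB hirr
  -- `Var_π(f) = ‖f̄‖²_π = Σ_j a_j²` with `a_j = ⟨f̄, f_j⟩_π`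
  have hVar : lawVariance π f = ∑ j, piInner π (centred π f) (specFun hA j) ^ 2 := by
    have h0 := piInner_pow_mulVec_eq_sum hπ hA (centred π f) 0
    rw [pow_zero, one_mulVec] at h0
    rw [← piInner_centred_eq_lawVariance]
    change piInner π (centred π f) (centred π f) = _
    rw [h0]
    exact sum_congr rfl fun j _ => by rw [pow_zero, mul_one]
  rw [varSum_eq_sum_modes hπ hπ1 hP hDB hA f t, hVar, le_div_iff₀ hγ, sum_mul, mul_sum]
  -- mode by mode: `a_j²·E_j(t)·γ ≤ 2t·a_j²`
  refine sum_le_sum fun j _ => ?_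
  have key : ∀ (a E : ℝ), (a = 0 ∨ spectralGap π P * E ≤ 2 * t) →
      a ^ 2 * E * spectralGap π P ≤ 2 * t * a ^ 2 := by
    intro a E h
    rcases h with h | h
    · rw [h]; simp
    · calc a ^ 2 * E * spectralGap π P = a ^ 2 * (spectralGap π P * E) := by ring
        _ ≤ a ^ 2 * (2 * t) := mul_le_mul_of_nonneg_left h (sq_nonneg _)
        _ = 2 * t * a ^ 2 := by ring
  refine key _ _ ?_
  by_cases hj : specVal hA j = 1
  · -- `λ_j = 1`: `f_j` is constant (irreducibility), so `a_j = ⟨f̄, f_j⟩_π = 0`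
    left
    unfold piInner
    calc ∑ x, π x * (centred π f x * specFun hA j x)
        = specFun hA j (Classical.arbitrary X) * ∑ x, π x * centred π f x := by
          rw [mul_sum]
          exact sum_congr rfl fun x _ => by
            rw [specFun_apply_eq_of_specVal_eq_one hπ hP hirr hA hj x (Classical.arbitrary X)]
            ring
      _ = 0 := by rw [sum_mul_centred hπ1 f, mul_zero]
  · -- `λ_j ≠ 1`: `(1 − λ_j)E_j ≤ 2t` and `0 < γ ≤ 1 − λ_j`
    right
    have hl := abs_le.1 (abs_specVal_le_one hπ hP hA hj)
    have hmode := one_sub_mul_modeSum_le hl.1 hl.2 t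
    have hmem : specVal hA j ∈ orthEigenvalues π P := by
      rw [orthEigenvalues_eq hπ hπ1 hP hDB hirr hA]; exact ⟨j, hj, rfl⟩
    have hle : specVal hA j ≤ 1 - spectralGap π P := by
      rw [LevinPeres2017_lemma_13_7 hπ hπ1 hP hDB]
      exact le_of_mem_orthEigenvalues hπ hP hst hmem
    have hγle : spectralGap π P ≤ 1 - specVal hA j := by linarith
    rcases le_or_gt 0 (∑ r ∈ range t, (1 + 2 * ∑ i ∈ range r, specVal hA j ^ (i + 1)))
      with hE0 | hE0
    · exact (mul_le_mul_of_nonneg_right hγle hE0).trans hmode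
    · have h1 : spectralGap π P *
          ∑ r ∈ range t, (1 + 2 * ∑ i ∈ range r, specVal hA j ^ (i + 1)) ≤ 0 :=
        mul_nonpos_of_nonneg_of_nonpos hγ.le hE0.le
      have h2 : (0 : ℝ) ≤ 2 * t := by positivity
      linarith

/-- **Lemma 12.22 for the time AVERAGE**: `Var_π[t⁻¹ Σ_{s<t} f(X_s)] ≤ 2·Var_π(f)/(γ·t)` (`t ≥ 1`) —
"order `[Var_π(f)/η²]γ⁻¹` samples suffice". [cite: LevinPeres2017, §12.7 Lemma 12.22 eq. (12.31)
with the sentence before Thm 12.21] -/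
theorem LevinPeres2017_lemma_12_22_avg [Nontrivial X] (hπ : ∀ x, 0 < π x) (hπ1 : ∑ x, π x = 1)
    (hP : IsRowStochastic P) (hDB : DetailedBalance π P) (hirr : IsIrreducible P) (f : X → ℝ)
    {t : ℕ} (ht : 0 < t) :
    varSum f π P t / (t : ℝ) ^ 2 ≤ 2 * lawVariance π f / (spectralGap π P * t) := by
  have h := LevinPeres2017_lemma_12_22 hπ hπ1 hP hDB hirr f t
  have hγ := spectralGap_pos hπ hπ1 hP hDB hirr
  have htpos : (0 : ℝ) < t := by exact_mod_cast ht
  rw [le_div_iff₀ hγ] at h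
  rw [div_le_iff₀ (by positivity), div_mul_eq_mul_div, le_div_iff₀ (by positivity)]
  calc varSum f π P t * (spectralGap π P * t) = varSum f π P t * spectralGap π P * t := by ring
    _ ≤ 2 * t * lawVariance π f * t := mul_le_mul_of_nonneg_right h htpos.le
    _ = 2 * lawVariance π f * (t : ℝ) ^ 2 := by ring

end Variance

end Literature.Probability.MarkovChains
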